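import Literature.Computability.Complexity.FoldBricks
import Literature.Computability.Complexity.ListBricks
import Literature.Computability.Complexity.SmoothQuasiPoly
import HarnessLib

/-!
# Selection bricks: argmax/argmin tracking folds, fixed powers, coin chunks, framed list bodies

Trunk `CplxCore`, toolkit in the `FP`-algebra style of `FoldBricks.lean` (`foldLoop op f p` with
its model `foldAcc`). This file adds the generic pieces a "try all candidates, keep the best,
then emit a code" machine needs (the oracle machine of Regev's decision-to-search reduction,
`Cryptography/LWERegevMachine*.lean`, is assembled from them and from the existing bricks):

* `foldAcc_eq_foldl` — the fold model as a `List.foldl` over the indices;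
* the **selection operations** `selMaxOp` / `selMinOp` on `⟨⟨idx, val⟩, ⟨idx', val'⟩⟩`: keep the
  first record unless the second has a strictly larger (resp. smaller) value — one of the two
  arguments, so of additive growth (`length_selMaxOp_le`, `length_selMinOp_le`), hence usable as the
  `op` of `foldLoop`; `foldAcc_selMaxOp` / `foldAcc_selMinOp`: folding pieces `⟨bin j, bin (F j)⟩`
  from `⟨bin i₀, bin (F i₀)⟩` tracks `(List.range …).foldl` of the strict-improvement scan — the
  FIRST best index (ties keep the earlier one);
(fixed powers `bin n ↦ bin (n^e)` are `Brick.natPowFn`, `SmoothQuasiPoly.lean`);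
* `chunkF` — `⟨ruler, ⟨1ᴷ, ⟨bin p, r⟩⟩⟩ ↦ (r ⇂ K·min(p,|ruler|)) ↾ K`, the `p`-th `K`-bit chunk of a
  coin string (`takeFn`, `dropFn`, `umulFn`, `binToUnaryFn`);
* `frames_ofFn_eq_ccat_boolPair` — the framed body of a list code is the concatenation of the
  one-item frames `boolPair (c i) ε`, the shape produced by an `appF`-fold (`foldAcc_appF`).

## References

* S. Arora, B. Barak, *Computational Complexity: A Modern Approach*, CUP 2009, §1.3 (polynomial
  time is closed under composition and bounded loops). [cite: AroraBarak2009, §1.3]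
-/

namespace Literature.Computability.Complexity

open _root_.Computability Polynomial Com Plumb HashBricks

namespace Brick

/-! ### The fold model as a `foldl` -/

/-- **`foldAcc` is a left fold over the indices `i, i+1, …, i+k-1`.** [folklore] -/
theorem foldAcc_eq_foldl (op f : List Bool → List Bool) (x : List Bool) : ∀ (k i : ℕ) (acc : List Bool),
    foldAcc op f x i k acc =
      ((List.range k).map (· + i)).foldl (fun a j => op (boolPair a (f (boolPair x (ones j))))) acc
  | 0, i, acc => rfl
  | k + 1, i, acc => by
    rw [foldAcc_succ', foldAcc_eq_foldl op f x k i acc, List.range_succ, List.map_append, List.foldl_append]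
    simp [Nat.add_comm]

/-! ### Selection operations -/

/-- The comparison bit `[⟦val acc⟧ < ⟦val piece⟧]` on `⟨acc, piece⟩`, `acc = ⟨idx, val⟩`,
`piece = ⟨idx', val'⟩`. [folklore] -/
noncomputable def ltValOp : List Bool → List Bool := ltFn ∘ fanoutFn (sndF ∘ fstF) (sndF ∘ sndF)

/-- The comparison bit `[⟦val piece⟧ < ⟦val acc⟧]`. [folklore] -/
noncomputable def gtValOp : List Bool → List Bool := ltFn ∘ fanoutFn (sndF ∘ sndF) (sndF ∘ fstF)

/-- **Keep the record of larger value** (the first one on ties): `⟨acc, piece⟩ ↦ piece` if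
`⟦val acc⟧ < ⟦val piece⟧`, else `acc`. [folklore] -/
noncomputable def selMaxOp : List Bool → List Bool := iteFn ltValOp sndF fstF

/-- **Keep the record of smaller value** (the first one on ties): `⟨acc, piece⟩ ↦ piece` if
`⟦val piece⟧ < ⟦val acc⟧`, else `acc`. [folklore] -/
noncomputable def selMinOp : List Bool → List Bool := iteFn gtValOp sndF fstF

/-- `ltValOp` is one-bit. [folklore] -/
theorem oneBit_ltValOp : OneBit ltValOp := oneBit_ltFn.comp _

/-- `gtValOp` is one-bit. [folklore] -/
theorem oneBit_gtValOp : OneBit gtValOp := oneBit_ltFn.comp _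

/-- `ltValOp ∈ FP`. [folklore] -/
theorem ltValOp_mem_FP : ltValOp ∈ FP :=
  comp_mem_FP ltFn_mem_FP (fanoutFn_mem_FP (comp_mem_FP sndF_mem_FP fstF_mem_FP) (comp_mem_FP sndF_mem_FP sndF_mem_FP))

/-- `gtValOp ∈ FP`. [folklore] -/
theorem gtValOp_mem_FP : gtValOp ∈ FP :=
  comp_mem_FP ltFn_mem_FP (fanoutFn_mem_FP (comp_mem_FP sndF_mem_FP sndF_mem_FP) (comp_mem_FP sndF_mem_FP fstF_mem_FP))

/-- `selMaxOp ∈ FP`. [folklore] -/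
theorem selMaxOp_mem_FP : selMaxOp ∈ FP := iteFn_mem_FP ltValOp_mem_FP sndF_mem_FP fstF_mem_FP

/-- `selMinOp ∈ FP`. [folklore] -/
theorem selMinOp_mem_FP : selMinOp ∈ FP := iteFn_mem_FP gtValOp_mem_FP sndF_mem_FP fstF_mem_FP

/-- `selMaxOp` on a pair of records. [folklore] -/
theorem selMaxOp_boolPair (i v i' v' : List Bool) :
    selMaxOp (boolPair (boolPair i v) (boolPair i' v')) =
      if bitsToNat v < bitsToNat v' then boolPair i' v' else boolPair i v := by
  rw [selMaxOp, iteFn_apply (b := decide (bitsToNat v < bitsToNat v')) (by simp [ltValOp])]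
  by_cases h : bitsToNat v < bitsToNat v' <;> simp [h]

/-- `selMinOp` on a pair of records. [folklore] -/
theorem selMinOp_boolPair (i v i' v' : List Bool) :
    selMinOp (boolPair (boolPair i v) (boolPair i' v')) =
      if bitsToNat v' < bitsToNat v then boolPair i' v' else boolPair i v := by
  rw [selMinOp, iteFn_apply (b := decide (bitsToNat v' < bitsToNat v)) (by simp [gtValOp])]
  by_cases h : bitsToNat v' < bitsToNat v <;> simp [h]

/-- Growth of `selMaxOp`: one of its two arguments. [folklore] -/
theorem length_selMaxOp_le (w : List Bool) : (selMaxOp w).length ≤ (fstF w).length + (sndF w).length + 0 := by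
  rw [selMaxOp, iteFn_of_oneBit oneBit_ltValOp]
  split_ifs <;> simp

/-- Growth of `selMinOp`: one of its two arguments. [folklore] -/
theorem length_selMinOp_le (w : List Bool) : (selMinOp w).length ≤ (fstF w).length + (sndF w).length + 0 := by
  rw [selMinOp, iteFn_of_oneBit oneBit_gtValOp]
  split_ifs <;> simp

/-- **The argmax-tracking fold.** Folding the pieces `⟨bin j, bin (F j)⟩`, `j = i, …, i+k-1`, into
`⟨bin j₀, bin (F j₀)⟩` with `selMaxOp` yields `⟨bin j*, bin (F j*)⟩` where `j*` is the result of the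
strict-improvement scan `foldl (fun b j => if F b < F j then j else b) j₀`. [folklore] -/
theorem foldAcc_selMaxOp {f : List Bool → List Bool} {x : List Bool} (F : ℕ → ℕ)
    (hf : ∀ j, f (boolPair x (ones j)) = boolPair (encodeNat j) (encodeNat (F j))) (k i j₀ : ℕ) :
    foldAcc selMaxOp f x i k (boolPair (encodeNat j₀) (encodeNat (F j₀))) =
      boolPair (encodeNat (((List.range k).map (· + i)).foldl (fun b j => if F b < F j then j else b) j₀))
        (encodeNat (F (((List.range k).map (· + i)).foldl (fun b j => if F b < F j then j else b) j₀))) := by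
  rw [foldAcc_eq_foldl]
  generalize (List.range k).map (· + i) = l
  induction l generalizing j₀ with
  | nil => rfl
  | cons j l ih =>
    rw [List.foldl_cons, List.foldl_cons, hf, selMaxOp_boolPair, bitsToNat_encodeNat, bitsToNat_encodeNat]
    by_cases h : F j₀ < F j
    · rw [if_pos h, if_pos h, ih]
    · rw [if_neg h, if_neg h, ih]

/-- **The argmin-tracking fold** (strictly smaller replaces). [folklore] -/
theorem foldAcc_selMinOp {f : List Bool → List Bool} {x : List Bool} (F : ℕ → ℕ)
    (hf : ∀ j, f (boolPair x (ones j)) = boolPair (encodeNat j) (encodeNat (F j))) (k i j₀ : ℕ) :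
    foldAcc selMinOp f x i k (boolPair (encodeNat j₀) (encodeNat (F j₀))) =
      boolPair (encodeNat (((List.range k).map (· + i)).foldl (fun b j => if F j < F b then j else b) j₀))
        (encodeNat (F (((List.range k).map (· + i)).foldl (fun b j => if F j < F b then j else b) j₀))) := by
  rw [foldAcc_eq_foldl]
  generalize (List.range k).map (· + i) = l
  induction l generalizing j₀ with
  | nil => rfl
  | cons j l ih =>
    rw [List.foldl_cons, List.foldl_cons, hf, selMinOp_boolPair, bitsToNat_encodeNat, bitsToNat_encodeNat]
    by_cases h : F j < F j₀
    · rw [if_pos h, if_pos h, ih]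
    · rw [if_neg h, if_neg h, ih]

/-- **The max fold**: `op = ⟨acc, v⟩ ↦` the larger numeral. [folklore] -/
noncomputable def maxOp : List Bool → List Bool := iteFn ltFn sndF fstF

/-- `maxOp ∈ FP`. [folklore] -/
theorem maxOp_mem_FP : maxOp ∈ FP := iteFn_mem_FP ltFn_mem_FP sndF_mem_FP fstF_mem_FP

/-- `maxOp` on a pair of numerals. [folklore] -/
theorem maxOp_boolPair (a b : List Bool) :
    maxOp (boolPair a b) = if bitsToNat a < bitsToNat b then b else a := by
  rw [maxOp, iteFn_apply (b := decide (bitsToNat a < bitsToNat b)) (ltFn_boolPair a b)]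
  by_cases h : bitsToNat a < bitsToNat b <;> simp [h]

/-- Growth of `maxOp`: one of its two arguments. [folklore] -/
theorem length_maxOp_le (w : List Bool) : (maxOp w).length ≤ (fstF w).length + (sndF w).length + 0 := by
  rw [maxOp, iteFn_of_oneBit oneBit_ltFn]
  split_ifs <;> simp

/-- **The max fold over canonical numerals** computes the canonical numeral of the maximum
(`0` for no pieces). [folklore] -/
theorem foldAcc_maxOp {f : List Bool → List Bool} {x : List Bool} (F : ℕ → ℕ)
    (hf : ∀ j, f (boolPair x (ones j)) = encodeNat (F j)) (k i a : ℕ) :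
    foldAcc maxOp f x i k (encodeNat a) =
      encodeNat (((List.range k).map (· + i)).foldl (fun b j => max b (F j)) a) := by
  rw [foldAcc_eq_foldl]
  generalize (List.range k).map (· + i) = l
  induction l generalizing a with
  | nil => rfl
  | cons j l ih =>
    rw [List.foldl_cons, List.foldl_cons, hf, maxOp_boolPair, bitsToNat_encodeNat, bitsToNat_encodeNat]
    by_cases h : a < F j
    · rw [if_pos h, max_eq_right h.le, ih]
    · rw [if_neg h, max_eq_left (not_lt.1 h), ih]

/-! ### Chunks of a coin string -/

/-- **The chunk brick**: on `⟨ruler, ⟨1ᴷ, ⟨bin p, r⟩⟩⟩`, the `K`-bit chunk number `p` of `r`,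
`(r ⇂ K · min(p, |ruler|)) ↾ K` (the ruler caps the unary conversion of `p`). [folklore] -/
noncomputable def chunkF : List Bool → List Bool :=
  takeFn ∘ fanoutFn (nthF 1)
    (dropFn ∘ fanoutFn (umulFn ∘ fanoutFn (nthF 1) (binToUnaryFn ∘ fanoutFn (nthF 0) (nthF 2))) (sndPow 2))

/-- `chunkF ∈ FP`. [folklore] -/
theorem chunkF_mem_FP : chunkF ∈ FP :=
  comp_mem_FP takeFn_mem_FP (fanoutFn_mem_FP (nthF_mem_FP 1)
    (comp_mem_FP dropFn_mem_FP (fanoutFn_mem_FP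
      (comp_mem_FP umulFn_mem_FP (fanoutFn_mem_FP (nthF_mem_FP 1)
        (comp_mem_FP binToUnaryFn_mem_FP (fanoutFn_mem_FP (nthF_mem_FP 0) (nthF_mem_FP 2)))))
      (sndPow_mem_FP 2))))

/-- **Value of `chunkF`.** [folklore] -/
theorem chunkF_apply (ruler : List Bool) (K : ℕ) (bp r : List Bool) :
    chunkF (boolPair ruler (boolPair (ones K) (boolPair bp r))) =
      (r.drop (K * min (bitsToNat bp) ruler.length)).take K := by
  simp [chunkF, umulFn_apply, ones]

/-! ### Framed list bodies as concatenations -/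

/-- **The framed body of a list code is the concatenation of one-item frames `boolPair (c i) ε`.**
[folklore] -/
theorem frames_ofFn_eq_ccat_boolPair (c : ℕ → List Bool) (n : ℕ) :
    frames (List.ofFn fun i : Fin n => c i) = ccat (fun i => boolPair (c i) []) n := by
  rw [frames_ofFn]
  exact ccat_congr fun i _ => by rw [boolPair_eq, List.append_nil]

end Brick

end Literature.Computability.Complexity
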